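import Summits.QuantumFields.YangMills.Theorems.ColdStartUniversalityLatticeLangevinWilsonSemigroupPoincare
import HarnessLib

/-!
# Route `ColdStartUniversality` (fixed-cut-off `L²(μ_{β'})` package): GENERATOR-FORM POINCARÉ ⇒ SEMIGROUP-FORM POINCARÉ, GIVEN
# SMOOTHING — what exactly is left of the hypothesis `hEquiv`

Helper file (seat `ym-line-csu-p1`, g17; `--supports stmt-QuantumFields-27363`).  Third part of the semigroup-form Poincaré package
(`…WilsonSemigroupConvexity`, `…WilsonSemigroupPoincare`).  There, for the reversible SZZ kernels at any `L, β'`, the Poincaré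
inequality for the SEMIGROUP Dirichlet form `𝓔_h(G) = h⁻¹(∫ G² dμ − ∫ G κ_h G dμ)` on `C(X)` was shown EQUIVALENT to exponential
`L²(μ_{β'})` decay with the same constant.  A functional-inequality proof (Bakry–Émery, multiscale/Polchinski, …) delivers instead
the GENERATOR form `λ Var_μ(F) ≤ −∫ (F − μF) 𝓛f dμ` on `C³` cylinder functions `F = f∘coords` — the hypothesis shape of g16's
`uniformL2Gap_of_uniformPoincare`.  The two agree on `C³` cylinders (`tendsto_dirichletForm_semigroup`: `𝓔_h(F) ↑ −∫ F 𝓛f dμ`);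
passing from cylinders to `C(X)` is the core / essential-self-adjointness step of Bakry–Gentil–Ledoux §3.2.  This file proves that
step from ONE regularity input, stated as a hypothesis on the kernels:

  SMOOTHING `(S)`: for every `s > 0` and every continuous `H`, `κ_s H = f_s ∘ coords` on `SU(2)^E` for some `C³` compactly
  supported `f_s` (hypoelliptic smoothing of the elliptic SZZ semigroup; Hörmander / parabolic regularity — NOT in the tree).

* §1 `eventually_lt_dirichletScale_of_generatorPoincare` — abstract bookkeeping: the generator-form inequality for `F = f∘c`
  plus `τ⁻¹(∫ Fκ_τF − ∫F²) → ∫ F·g` and `∫ g dμ = 0` give `λ Var(F) − ε < 𝓔_τ(F)` for all small `τ`;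
  `dirichletScale_nonneg` — `𝓔_h(G) ≥ 0`.
* §2 ★★ `semigroupPoincare_of_generatorPoincare_of_smoothing` — `(S)` + generator-form Poincaré(`λ`) on `C³` cylinders ⇒
  semigroup-form Poincaré(`λ`) on `C(X)`: for continuous `G`, `λ Var(κ_sG) ≤ 𝓔(κ_sG) ≤ 𝓔_τ(κ_sG) + ε ≤ 𝓔_τ(G) + ε`
  (`dirichletScale_transition_le`: the form contracts along the semigroup) and `Var(κ_sG) → Var(G)` as `s ↓ 0`.
  ★ `integral_sq_transition_sub_le_exp_of_generatorPoincare_of_smoothing` — hence `(S)` + generator-form Poincaré(`λ`) ⇒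
  `∫ (κ_tG − μG)² dμ ≤ e^{−2λt} Var_μ(G)` for all continuous `G`: THE BODY OF `hEquiv` at `(L, β', λ)`, conditional on `(S)` only.

THEOREMS ONLY, no definition, no sorry.  HONEST FRAMING: RECORD-rung R3 plumbing at FIXED cut-off; `(S)` is a hypothesis (the
one analytic input of `hEquiv` that the tree does not have); nothing K-uniform is proved; no crux, rung or summit statement is
proved; the Yang–Mills mass gap is NOT proved.
-/

set_option autoImplicit false

noncomputable section

namespace Summit.QuantumFields.YangMills.Theorems.ColdStartUniversality

open MeasureTheory ProbabilityTheory Filter Set Topology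
open scoped BigOperators NNReal ENNReal
open Literature.Probability.Process Literature.MathematicalPhysics.QuantumFieldTheory
open Literature.MathematicalPhysics.QuantumLattice (fundamentalRep fundamentalLatticeRep continuous_fundamentalRep)

/-! ## §1. Abstract bookkeeping -/

/-- **Generator-form Poincaré + the small-time limit of the semigroup form ⇒ a lower bound on `𝓔_τ` for small `τ`.**  On a
probability space: if `F = f∘c` satisfies `λ ∫(F − μF)² ≤ −∫ (F − μF) g` with `∫ g = 0`, and `τ⁻¹(A τ − ∫ F²) → ∫ F g` as `τ ↓ 0`, then
for every `ε > 0`, eventually `λ Var(F) − ε < τ⁻¹(∫ F² − A τ)`. [folklore] -/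
theorem eventually_lt_dirichletScale_of_generatorPoincare {X : Type*} [MeasurableSpace X] {μ : Measure X}
    [IsProbabilityMeasure μ] {ι : Type*} {f : (ι → ℝ) → ℝ} {c : X → ι → ℝ} {Fs g : X → ℝ} {A B : ℝ → X → ℝ} {lam : ℝ}
    (hfeq : ∀ V, Fs V = f (c V)) (hg0 : ∫ V, g V ∂μ = 0)
    (hgi : Integrable g μ) (hFgi : Integrable (fun V => Fs V * g V) μ)
    (hP : lam * ∫ V, (f (c V) - ∫ V', f (c V') ∂μ) ^ 2 ∂μ ≤ -∫ V, (f (c V) - ∫ V', f (c V') ∂μ) * g V ∂μ)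
    (hT : Tendsto (fun τ : ℝ => τ⁻¹ * ((∫ V, f (c V) * A τ V ∂μ) - ∫ V, f (c V) * f (c V) ∂μ)) (𝓝[>] 0)
      (𝓝 (∫ V, f (c V) * g V ∂μ)))
    (hAB : ∀ τ V, A τ V = B τ V) {ε : ℝ} (hε : 0 < ε) :
    ∀ᶠ τ : ℝ in 𝓝[>] 0,
      lam * ∫ V, (Fs V - ∫ V', Fs V' ∂μ) ^ 2 ∂μ - ε < τ⁻¹ * ((∫ V, Fs V * Fs V ∂μ) - ∫ V, Fs V * B τ V ∂μ) := by
  have e : ∀ V, f (c V) = Fs V := fun V => (hfeq V).symm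
  simp only [e, hAB] at hP hT
  set m : ℝ := ∫ V', Fs V' ∂μ with hm
  have h1 : ∫ V, (Fs V - m) * g V ∂μ = ∫ V, Fs V * g V ∂μ := by
    have ee : ∀ V, (Fs V - m) * g V = Fs V * g V - m * g V := fun V => by ring
    simp_rw [ee]
    rw [integral_sub hFgi (hgi.const_mul m), integral_const_mul, hg0, mul_zero, sub_zero]
  rw [h1] at hP
  have hT' : Tendsto (fun τ : ℝ => τ⁻¹ * ((∫ V, Fs V * Fs V ∂μ) - ∫ V, Fs V * B τ V ∂μ)) (𝓝[>] 0)
      (𝓝 (-(∫ V, Fs V * g V ∂μ))) :=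
    hT.neg.congr' (Eventually.of_forall fun τ => by ring)
  have hlt : lam * ∫ V, (Fs V - m) ^ 2 ∂μ - ε < -(∫ V, Fs V * g V ∂μ) := by linarith
  exact hT'.eventually (eventually_gt_nhds hlt)

variable {L : ℕ} [NeZero L]

/-- **`𝓔_h(G) ≥ 0`**: `∫ G κ_h G dμ_{β'} ≤ ∫ G² dμ_{β'}` for continuous `G` (the `L²`-contraction, `integral_mul_transition_self_antitone`
at `t = 0`, `κ_0 = id`). [cite: ShenZhuZhu2022, §3 (p. 13)] -/
theorem dirichletScale_nonneg (L : ℕ) [NeZero L] (β' : ℝ)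
    (κ : ℝ≥0 → Kernel (GaugeConfig 3 L (Matrix.specialUnitaryGroup (Fin 2) ℂ))
      (GaugeConfig 3 L (Matrix.specialUnitaryGroup (Fin 2) ℂ))) [∀ t, IsMarkovKernel (κ t)]
    (hreal : ∀ (t : ℝ≥0) (x : GaugeConfig 3 L (Matrix.specialUnitaryGroup (Fin 2) ℂ))
        (Ω : Type) [MeasurableSpace Ω] (P : Measure Ω) [IsProbabilityMeasure P]
        (W : ℝ≥0 → Ω → (Edge 3 L × NoiseIdx 2 → ℝ)) (hW : IsFlatBrownian W P)
        (U : ℝ≥0 → Ω → GaugeConfig 3 L (Matrix.specialUnitaryGroup (Fin 2) ℂ)),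
        (∀ ω, U 0 ω = x) →
        (latticeLangevinDynamics (fundamentalLatticeRep 2) β').IsSolution (fundamentalRep (Fin 2))
          hW.natFiltration P W U →
        κ t x = P.map (U t))
    (h : ℝ≥0) {G : GaugeConfig 3 L (Matrix.specialUnitaryGroup (Fin 2) ℂ) → ℝ} (hG : Continuous G) :
    0 ≤ (h : ℝ)⁻¹ * ((∫ x, G x * G x ∂(wilsonMeasure (d := 3) (L := L) (fundamentalRep (Fin 2)) β')) -
        ∫ x, G x * (∫ y, G y ∂(κ h x)) ∂(wilsonMeasure (d := 3) (L := L) (fundamentalRep (Fin 2)) β')) := by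
  have ha := integral_mul_transition_self_antitone L β' κ hreal 0 h hG
  rw [zero_add, transitionKernel_zero_eq_id L β' κ hreal] at ha
  simp only [Kernel.id_apply, integral_dirac] at ha
  exact mul_nonneg (inv_nonneg.2 h.2) (by linarith)

/-! ## §2. Smoothing + generator-form Poincaré ⇒ semigroup-form Poincaré ⇒ decay -/

/-- ★★ **Generator-form Poincaré on `C³` cylinders + smoothing ⇒ semigroup-form Poincaré on `C(X)`, same constant.**  Assume
`(S)`: for every `s > 0` and continuous `H`, `κ_s H = f_s∘coords` with `f_s` `C³` of compact support; and the Poincaré inequality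
`λ Var_μ(F) ≤ −∫ (F − μF) 𝓛f dμ` for every `C³` `f`, `F = f∘coords` (the hypothesis shape of `uniformL2Gap_of_uniformPoincare`).
Then every continuous `G` satisfies, for every `η > 0`, `(λ − η) Var_μ(G) ≤ 𝓔_h(G)` for some `h > 0`.  Proof: for `Var(G) > 0`,
`λ > 0`: `Var(κ_sG) → Var(G)` (`s ↓ 0`, continuity of `u ↦ ⟨G₀, κ_uG₀⟩`); at a good `s`, `F = κ_sG = f_s∘coords` has
`λ Var(F) ≤ −∫ F 𝓛f_s = lim_τ 𝓔_τ(F)` (`integral_generator_wilson_eq_zero`, `tendsto_dirichletForm_semigroup`) and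
`𝓔_τ(F) ≤ 𝓔_τ(G)` (`dirichletScale_transition_le`). [cite: BakryGentilLedoux2014, §3.2 and Thm 4.2.5] -/
theorem semigroupPoincare_of_generatorPoincare_of_smoothing (L : ℕ) [NeZero L] (β' : ℝ)
    (κ : ℝ≥0 → Kernel (GaugeConfig 3 L (Matrix.specialUnitaryGroup (Fin 2) ℂ))
      (GaugeConfig 3 L (Matrix.specialUnitaryGroup (Fin 2) ℂ))) [∀ t, IsMarkovKernel (κ t)]
    (hreal : ∀ (t : ℝ≥0) (x : GaugeConfig 3 L (Matrix.specialUnitaryGroup (Fin 2) ℂ))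
        (Ω : Type) [MeasurableSpace Ω] (P : Measure Ω) [IsProbabilityMeasure P]
        (W : ℝ≥0 → Ω → (Edge 3 L × NoiseIdx 2 → ℝ)) (hW : IsFlatBrownian W P)
        (U : ℝ≥0 → Ω → GaugeConfig 3 L (Matrix.specialUnitaryGroup (Fin 2) ℂ)),
        (∀ ω, U 0 ω = x) →
        (latticeLangevinDynamics (fundamentalLatticeRep 2) β').IsSolution (fundamentalRep (Fin 2))
          hW.natFiltration P W U →
        κ t x = P.map (U t))
    -- (S) SMOOTHING: `κ_s C(X) ⊆ {f∘coords : f ∈ C³_c}` for every `s > 0`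
    (hsmooth : ∀ s : ℝ≥0, 0 < s → ∀ H : GaugeConfig 3 L (Matrix.specialUnitaryGroup (Fin 2) ℂ) → ℝ, Continuous H →
      let coords : GaugeConfig 3 L (Matrix.specialUnitaryGroup (Fin 2) ℂ) → (Edge 3 L × Fin 2 × Fin 2 × Bool → ℝ) :=
        fun V q => (fun z : ℂ => if q.2.2.2 then z.im else z.re)
          ((fundamentalRep (Fin 2) (V q.1) : Matrix (Fin 2) (Fin 2) ℂ) q.2.1 q.2.2.1)
      ∃ f : (Edge 3 L × Fin 2 × Fin 2 × Bool → ℝ) → ℝ, ContDiff ℝ 3 f ∧ HasCompactSupport f ∧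
        ∀ V, ∫ y, H y ∂(κ s V) = f (coords V))
    {lam : ℝ}
    -- GENERATOR-FORM POINCARÉ INEQUALITY on `C³` cylinder functions (verbatim the hypothesis shape of `hEquiv`)
    (hPgen : ∀ (f : (Edge 3 L × Fin 2 × Fin 2 × Bool → ℝ) → ℝ), ContDiff ℝ 3 f →
        let coords : GaugeConfig 3 L (Matrix.specialUnitaryGroup (Fin 2) ℂ) → (Edge 3 L × Fin 2 × Fin 2 × Bool → ℝ) :=
          fun V q => (fun z : ℂ => if q.2.2.2 then z.im else z.re)
            ((fundamentalRep (Fin 2) (V q.1) : Matrix (Fin 2) (Fin 2) ℂ) q.2.1 q.2.2.1)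
        let gen : GaugeConfig 3 L (Matrix.specialUnitaryGroup (Fin 2) ℂ) → ℝ := fun V =>
          (∑ i : Edge 3 L × Fin 2 × Fin 2 × Bool, fderiv ℝ f (coords V) (Pi.single i 1) *
              (fun z : ℂ => if i.2.2.2 then z.im else z.re)
                ((latticeLangevinDynamics (fundamentalLatticeRep 2) β').drift
                  (matrixConfig (fundamentalRep (Fin 2)) V) i.1 i.2.1 i.2.2.1) +
          1 / 2 * ∑ i : Edge 3 L × Fin 2 × Fin 2 × Bool, ∑ j : Edge 3 L × Fin 2 × Fin 2 × Bool,
            fderiv ℝ (fun z => fderiv ℝ f z (Pi.single i 1)) (coords V) (Pi.single j 1) *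
              ∑ n : Edge 3 L × NoiseIdx 2,
                (if n.1 = i.1 then (fun z : ℂ => if i.2.2.2 then z.im else z.re)
                  ((latticeLangevinDynamics (fundamentalLatticeRep 2) β').noise
                    (matrixConfig (fundamentalRep (Fin 2)) V) i.1 n.2 i.2.1 i.2.2.1) else 0) *
                (if n.1 = j.1 then (fun z : ℂ => if j.2.2.2 then z.im else z.re)
                  ((latticeLangevinDynamics (fundamentalLatticeRep 2) β').noise
                    (matrixConfig (fundamentalRep (Fin 2)) V) j.1 n.2 j.2.1 j.2.2.1) else 0))
        lam * ∫ V, (f (coords V) - ∫ V', f (coords V') ∂(wilsonMeasure (d := 3) (L := L) (fundamentalRep (Fin 2)) β')) ^ 2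
            ∂(wilsonMeasure (d := 3) (L := L) (fundamentalRep (Fin 2)) β') ≤
          -∫ V, (f (coords V) - ∫ V', f (coords V') ∂(wilsonMeasure (d := 3) (L := L) (fundamentalRep (Fin 2)) β')) *
            gen V ∂(wilsonMeasure (d := 3) (L := L) (fundamentalRep (Fin 2)) β'))
    {G : GaugeConfig 3 L (Matrix.specialUnitaryGroup (Fin 2) ℂ) → ℝ} (hG : Continuous G) {η : ℝ} (hη : 0 < η) :
    ∃ h : ℝ≥0, 0 < h ∧
      (lam - η) * ∫ x, (G x - ∫ z, G z ∂(wilsonMeasure (d := 3) (L := L) (fundamentalRep (Fin 2)) β')) ^ 2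
          ∂(wilsonMeasure (d := 3) (L := L) (fundamentalRep (Fin 2)) β') ≤
        (h : ℝ)⁻¹ * ((∫ x, G x * G x ∂(wilsonMeasure (d := 3) (L := L) (fundamentalRep (Fin 2)) β')) -
          ∫ x, G x * (∫ y, G y ∂(κ h x)) ∂(wilsonMeasure (d := 3) (L := L) (fundamentalRep (Fin 2)) β')) := by
  classical
  haveI := secondCountableTopology_su2
  haveI := borelSpace_config L
  set μ : Measure (GaugeConfig 3 L (Matrix.specialUnitaryGroup (Fin 2) ℂ)) :=
    wilsonMeasure (d := 3) (L := L) (fundamentalRep (Fin 2)) β' with hμ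
  haveI : IsProbabilityMeasure μ :=
    isProbabilityMeasure_wilsonMeasure (d := 3) (L := L) (fundamentalRep (Fin 2)) (continuous_fundamentalRep (Fin 2)) β'
  set m : ℝ := ∫ z, G z ∂μ with hm
  set Vr : ℝ := ∫ x, (G x - m) ^ 2 ∂μ with hVr
  have hVr0 : 0 ≤ Vr := integral_nonneg fun x => sq_nonneg _
  -- trivial cases: `Var(G) = 0` or `λ ≤ η`
  by_cases htriv : (lam - η) * Vr ≤ 0
  · exact ⟨1, one_pos, htriv.trans (dirichletScale_nonneg L β' κ hreal 1 hG)⟩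
  have hVpos : 0 < Vr := by
    rcases hVr0.lt_or_eq with h | h
    · exact h
    · exfalso; apply htriv; rw [← h, mul_zero]
  have hlam : 0 < lam := by
    by_contra hle
    apply htriv
    exact mul_nonpos_of_nonpos_of_nonneg (by linarith) hVr0
  -- the centred observable and its quadratic form
  set G₀ : GaugeConfig 3 L (Matrix.specialUnitaryGroup (Fin 2) ℂ) → ℝ := fun x => G x - m with hG₀
  have hG₀c : Continuous G₀ := hG.sub continuous_const
  obtain ⟨M, hM0, hM⟩ := exists_abs_le_of_continuous hG
  obtain ⟨M₀, hM₀0, hM₀⟩ := exists_abs_le_of_continuous hG₀c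
  have hGi : ∀ (ν : Measure (GaugeConfig 3 L (Matrix.specialUnitaryGroup (Fin 2) ℂ))) [IsProbabilityMeasure ν],
      Integrable G ν := fun ν _ =>
    Integrable.of_bound hG.aestronglyMeasurable M (Eventually.of_forall fun z => by rw [Real.norm_eq_abs]; exact hM z)
  have hκG₀ : ∀ (u : ℝ≥0) x, ∫ y, G₀ y ∂(κ u x) = (∫ y, G y ∂(κ u x)) - m := by
    intro u x
    simp only [hG₀]
    rw [integral_sub (hGi _) (integrable_const m), integral_const, probReal_univ, one_smul]
  have hκGm : ∀ u : ℝ≥0, ∫ x, (∫ y, G y ∂(κ u x)) ∂μ = m := fun u =>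
    integral_transitionKernel_integral_eq_wilson (L := L) β' κ hreal u hG.measurable ⟨M, hM⟩
  -- `Var(κ_s G) = Φ(s + s)` with `Φ u = ∫ G₀ κ_u G₀`, continuous in `s`, `Φ 0 = Var(G)`
  set Φ : ℝ≥0 → ℝ := fun u => ∫ x, G₀ x * (∫ y, G₀ y ∂(κ u x)) ∂μ with hΦ
  have hΦc : Continuous fun s : ℝ≥0 => Φ (s + s) :=
    (continuous_integral_mul_transition L β' κ hreal hG₀c hG₀c).comp (continuous_id.add continuous_id)
  have hκ0 : κ 0 = Kernel.id := transitionKernel_zero_eq_id L β' κ hreal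
  have hΦ0 : Φ (0 + 0) = Vr := by
    simp only [hΦ, add_zero, hκ0, Kernel.id_apply, integral_dirac]
    exact integral_congr_ae (Eventually.of_forall fun x => by simp only [hG₀]; ring)
  have hΦvar : ∀ s : ℝ≥0, Φ (s + s) = ∫ x, ((∫ y, G y ∂(κ s x)) - m) ^ 2 ∂μ := by
    intro s
    simp only [hΦ]
    rw [integral_mul_transition_self_eq_sq L β' κ hreal s hG₀c]
    exact integral_congr_ae (Eventually.of_forall fun x => by simp only [hκG₀ s x])
  -- choose `s > 0` with `λ |Var(κ_sG) − Var(G)| ≤ η Var(G)/2`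
  have hev : ∀ᶠ s : ℝ≥0 in 𝓝 0, dist (Φ (s + s)) (Φ (0 + 0)) < η * Vr / (2 * lam) :=
    Metric.tendsto_nhds.1 (hΦc.tendsto 0) _ (by positivity)
  obtain ⟨δ, hδ, hball⟩ := Metric.eventually_nhds_iff.1 hev
  set s : ℝ≥0 := ⟨δ / 2, by positivity⟩ with hs
  have hspos : 0 < s := by
    show (0 : ℝ≥0) < ⟨δ / 2, _⟩
    exact_mod_cast (show (0 : ℝ) < δ / 2 by positivity)
  have hsv : (s : ℝ) = δ / 2 := rfl
  have hsd : dist s 0 < δ := by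
    rw [NNReal.dist_eq, NNReal.coe_zero, sub_zero, hsv, abs_of_pos (by positivity)]
    linarith
  have hclose : |Φ (s + s) - Vr| < η * Vr / (2 * lam) := by
    have h := hball hsd
    rwa [Real.dist_eq, hΦ0] at h
  -- the smooth representative of `κ_s G`
  obtain ⟨f, hf, hfc, hfeq⟩ := hsmooth s hspos G hG
  have hFc : Continuous fun x => ∫ y, G y ∂(κ s x) := continuous_integral_transitionKernel L β' κ hreal s hG
  have hgc := continuous_generator (L := L) β' (hf.of_le (by norm_num))
  have hP := hPgen f hf
  have hT := tendsto_dirichletForm_semigroup L β' κ hreal hf hfc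
  have hg0 := integral_generator_wilson_eq_zero L β' hf hfc
  -- `λ Var(κ_sG) − ηVr/2 < 𝓔_τ(κ_sG)` for small `τ > 0`
  have hev2 := eventually_lt_dirichletScale_of_generatorPoincare (μ := μ)
    (Fs := fun x => ∫ y, G y ∂(κ s x))
    (B := fun (τ : ℝ) (x : GaugeConfig 3 L (Matrix.specialUnitaryGroup (Fin 2) ℂ)) =>
      ∫ y, (∫ z, G z ∂(κ s y)) ∂(κ τ.toNNReal x))
    hfeq hg0 (integrable_of_continuous_of_compactSpace hgc μ)
    (integrable_of_continuous_of_compactSpace (hFc.mul hgc) μ) hP hT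
    (fun τ x => integral_congr_ae (Eventually.of_forall fun y => (hfeq y).symm))
    (show (0 : ℝ) < η * Vr / 2 by positivity)
  obtain ⟨τ, hτ, hτpos⟩ := (hev2.and self_mem_nhdsWithin).exists
  have hτpos' : (0 : ℝ) < τ := hτpos
  refine ⟨τ.toNNReal, Real.toNNReal_pos.2 hτpos', ?_⟩
  have hcoe : ((τ.toNNReal : ℝ≥0) : ℝ) = τ := Real.coe_toNNReal _ hτpos'.le
  rw [hcoe]
  -- `Var(κ_sG) = Φ(s+s)` and the contraction `𝓔_τ(κ_sG) ≤ 𝓔_τ(G)`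
  have hVarFs : ∫ x, ((∫ y, G y ∂(κ s x)) - ∫ x', (∫ y, G y ∂(κ s x')) ∂μ) ^ 2 ∂μ = Φ (s + s) := by
    rw [hκGm s, hΦvar s]
  rw [hVarFs] at hτ
  have hcontr := dirichletScale_transition_le L β' κ hreal s τ.toNNReal hG
  have hclose' := (abs_lt.1 hclose)
  -- `λ Φ(s+s) ≥ λ Vr − η Vr/2`
  have hlamΦ : lam * Vr - η * Vr / 2 ≤ lam * Φ (s + s) := by
    have h1 : Vr - Φ (s + s) < η * Vr / (2 * lam) := by linarith [hclose'.1]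
    have h2 : lam * (Vr - Φ (s + s)) ≤ lam * (η * Vr / (2 * lam)) :=
      mul_le_mul_of_nonneg_left h1.le hlam.le
    have h3 : lam * (η * Vr / (2 * lam)) = η * Vr / 2 := by field_simp
    linarith [h2, h3]
  have hinv : 0 ≤ τ⁻¹ := inv_nonneg.2 hτpos'.le
  calc (lam - η) * Vr = (lam * Vr - η * Vr / 2) - η * Vr / 2 := by ring
    _ ≤ lam * Φ (s + s) - η * Vr / 2 := by linarith
    _ ≤ τ⁻¹ * ((∫ x, (∫ y, G y ∂(κ s x)) * (∫ y, G y ∂(κ s x)) ∂μ) -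
          ∫ x, (∫ y, G y ∂(κ s x)) * (∫ y, (∫ z, G z ∂(κ s y)) ∂(κ τ.toNNReal x)) ∂μ) := hτ.le
    _ ≤ τ⁻¹ * ((∫ x, G x * G x ∂μ) - ∫ x, G x * (∫ y, G y ∂(κ τ.toNNReal x)) ∂μ) :=
        mul_le_mul_of_nonneg_left hcontr hinv

/-- ★ **`hEquiv` at `(L, β', λ)`, conditional on smoothing only**: `(S)` + the generator-form Poincaré inequality with constant
`1/λ` on `C³` cylinder functions ⇒ `∫ (κ_t G − μG)² dμ_{β'} ≤ e^{−2λt} Var_{μ_{β'}}(G)` for every realising kernel family, every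
continuous `G` and every `t` (`semigroupPoincare_of_generatorPoincare_of_smoothing` then
`integral_sq_transition_sub_le_exp_of_semigroupPoincare`).  Conclusion = the body of the hypothesis `hEquiv` of
`uniformL2Gap_of_uniformPoincare` / `UniformColdStartMixing_of_uniformPoincare`. [cite: BakryGentilLedoux2014, Thm 4.2.5] -/
theorem integral_sq_transition_sub_le_exp_of_generatorPoincare_of_smoothing (L : ℕ) [NeZero L] (β' : ℝ)
    (κ : ℝ≥0 → Kernel (GaugeConfig 3 L (Matrix.specialUnitaryGroup (Fin 2) ℂ))
      (GaugeConfig 3 L (Matrix.specialUnitaryGroup (Fin 2) ℂ))) [∀ t, IsMarkovKernel (κ t)]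
    (hreal : ∀ (t : ℝ≥0) (x : GaugeConfig 3 L (Matrix.specialUnitaryGroup (Fin 2) ℂ))
        (Ω : Type) [MeasurableSpace Ω] (P : Measure Ω) [IsProbabilityMeasure P]
        (W : ℝ≥0 → Ω → (Edge 3 L × NoiseIdx 2 → ℝ)) (hW : IsFlatBrownian W P)
        (U : ℝ≥0 → Ω → GaugeConfig 3 L (Matrix.specialUnitaryGroup (Fin 2) ℂ)),
        (∀ ω, U 0 ω = x) →
        (latticeLangevinDynamics (fundamentalLatticeRep 2) β').IsSolution (fundamentalRep (Fin 2))
          hW.natFiltration P W U →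
        κ t x = P.map (U t))
    (hsmooth : ∀ s : ℝ≥0, 0 < s → ∀ H : GaugeConfig 3 L (Matrix.specialUnitaryGroup (Fin 2) ℂ) → ℝ, Continuous H →
      let coords : GaugeConfig 3 L (Matrix.specialUnitaryGroup (Fin 2) ℂ) → (Edge 3 L × Fin 2 × Fin 2 × Bool → ℝ) :=
        fun V q => (fun z : ℂ => if q.2.2.2 then z.im else z.re)
          ((fundamentalRep (Fin 2) (V q.1) : Matrix (Fin 2) (Fin 2) ℂ) q.2.1 q.2.2.1)
      ∃ f : (Edge 3 L × Fin 2 × Fin 2 × Bool → ℝ) → ℝ, ContDiff ℝ 3 f ∧ HasCompactSupport f ∧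
        ∀ V, ∫ y, H y ∂(κ s V) = f (coords V))
    {lam : ℝ}
    (hPgen : ∀ (f : (Edge 3 L × Fin 2 × Fin 2 × Bool → ℝ) → ℝ), ContDiff ℝ 3 f →
        let coords : GaugeConfig 3 L (Matrix.specialUnitaryGroup (Fin 2) ℂ) → (Edge 3 L × Fin 2 × Fin 2 × Bool → ℝ) :=
          fun V q => (fun z : ℂ => if q.2.2.2 then z.im else z.re)
            ((fundamentalRep (Fin 2) (V q.1) : Matrix (Fin 2) (Fin 2) ℂ) q.2.1 q.2.2.1)
        let gen : GaugeConfig 3 L (Matrix.specialUnitaryGroup (Fin 2) ℂ) → ℝ := fun V =>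
          (∑ i : Edge 3 L × Fin 2 × Fin 2 × Bool, fderiv ℝ f (coords V) (Pi.single i 1) *
              (fun z : ℂ => if i.2.2.2 then z.im else z.re)
                ((latticeLangevinDynamics (fundamentalLatticeRep 2) β').drift
                  (matrixConfig (fundamentalRep (Fin 2)) V) i.1 i.2.1 i.2.2.1) +
          1 / 2 * ∑ i : Edge 3 L × Fin 2 × Fin 2 × Bool, ∑ j : Edge 3 L × Fin 2 × Fin 2 × Bool,
            fderiv ℝ (fun z => fderiv ℝ f z (Pi.single i 1)) (coords V) (Pi.single j 1) *
              ∑ n : Edge 3 L × NoiseIdx 2,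
                (if n.1 = i.1 then (fun z : ℂ => if i.2.2.2 then z.im else z.re)
                  ((latticeLangevinDynamics (fundamentalLatticeRep 2) β').noise
                    (matrixConfig (fundamentalRep (Fin 2)) V) i.1 n.2 i.2.1 i.2.2.1) else 0) *
                (if n.1 = j.1 then (fun z : ℂ => if j.2.2.2 then z.im else z.re)
                  ((latticeLangevinDynamics (fundamentalLatticeRep 2) β').noise
                    (matrixConfig (fundamentalRep (Fin 2)) V) j.1 n.2 j.2.1 j.2.2.1) else 0))
        lam * ∫ V, (f (coords V) - ∫ V', f (coords V') ∂(wilsonMeasure (d := 3) (L := L) (fundamentalRep (Fin 2)) β')) ^ 2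
            ∂(wilsonMeasure (d := 3) (L := L) (fundamentalRep (Fin 2)) β') ≤
          -∫ V, (f (coords V) - ∫ V', f (coords V') ∂(wilsonMeasure (d := 3) (L := L) (fundamentalRep (Fin 2)) β')) *
            gen V ∂(wilsonMeasure (d := 3) (L := L) (fundamentalRep (Fin 2)) β'))
    {G : GaugeConfig 3 L (Matrix.specialUnitaryGroup (Fin 2) ℂ) → ℝ} (hG : Continuous G) (t : ℝ≥0) :
    ∫ x, ((∫ y, G y ∂(κ t x)) - ∫ z, G z ∂(wilsonMeasure (d := 3) (L := L) (fundamentalRep (Fin 2)) β')) ^ 2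
        ∂(wilsonMeasure (d := 3) (L := L) (fundamentalRep (Fin 2)) β') ≤
      Real.exp (-2 * lam * t) *
        ∫ x, (G x - ∫ z, G z ∂(wilsonMeasure (d := 3) (L := L) (fundamentalRep (Fin 2)) β')) ^ 2
          ∂(wilsonMeasure (d := 3) (L := L) (fundamentalRep (Fin 2)) β') :=
  integral_sq_transition_sub_le_exp_of_semigroupPoincare L β' κ hreal
    (fun _ hG' _ hη => semigroupPoincare_of_generatorPoincare_of_smoothing L β' κ hreal hsmooth hPgen hG' hη) hG t

end Summit.QuantumFields.YangMills.Theorems.ColdStartUniversality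

end
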